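import Summits.QuantumFields.BalabanUV.Beta.GAN24.OneStepLoopContractionLegs
import Summits.QuantumFields.BalabanUV.Beta.GAN24.KingWeightTwoLevel
import Summits.QuantumFields.BalabanUV.Beta.GAN24.OneStepConstraintAxialDelKVolumeLimitDecay

/-!
# `BalabanUV.Beta.GAN24.TentBackgroundLegs` — binder row G-an2-4 ∕ (CONV-C), routes C-R6° («VALUES») × R7 («TWO CURRENCIES»), PART 202:
# NON-VACUITY OF THE LEG CLASS — THE TENT FAMILY `V_{t,x}^{(k)}(u) = [μ = x₂]·max(−ρ_{k,x}(u), 0)` ABOUT EVERY UNIT BOND OF EVERY SOCKET VOLUME IS A LOCALISED LIPSCHITZ FAMILY WITH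
# POINTWISE LIMITS, SO PART 200's ONE-LOOP CONTRACTION END HOLDS FOR IT WITH NOTHING DISPLAYED.  PART 200 (`conv_oneLoop_loopCov_insertionLegs`) closed census V196 (ζ) for the
# class «localised `LipschitzBackground`s with pointwise limits about integer roots»; PART 201 showed the tent profile is in the Lipschitz half of that class (size 1, Lipschitz at its own
# spacing, two-spacing consistent by the one-step King-weight comparison, supported where `ρ_{k,x} ≤ 0`); this file adds the pointwise limits — the centre of the integer root `e(ẑ, μ′)` at
# level `k` is the reading of `n_k·z` (`ctr_unitIdx_symm_castT`), so the weight at the reading of a fixed integer bond is eventually `‖w − n_kz‖_∞∕n_k − 1` (PART 192's `tdist_castT_eventually`)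
# — and instantiates the END: the first family of leg data for which V196's loop contraction is a theorem with NO hypothesis at all (unit b2b-balaban-gan24-p3, gen 62; v1)

NOT IN PRINT; OUR PROOF ([folklore] bookkeeping BY NAME over PART 200 (`conv_oneLoop_loopCov_insertionLegs`), PART 201 (`lipschitzBackground_tent`, `rho_nonpos_of_tent_ne_zero`), PART 192
(`tdist_castT_eventually`), PART 139 (`up_castT_mul`), NE2's `CTKingTowerWeights` (`ctr`, `rho_apply`, `toM`) ∕ `BalabanAveragedCoerciveTower` (`unitIdx`, `unitSites`), PART 126 (`toM_eq_unitSites`),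
`B5Block118` (`up`, `iota`, `bpt`); [Balaban1987RG1] (1.20)–(1.22) p. 264 LOCATE the one-loop shape; nothing printed is a hypothesis).
HONEST FRAMING (cell contract, verbatim): «discharging `BetaPertH` makes Bałaban's UV stability UNCONDITIONAL — a real constructive-QFT result; it is NOT the
continuum limit and NOT the Clay problem.»  HONEST DEPENDENCY (verbatim): «continuum YM on T⁴ ⇐ BetaPertH ∧ nine spine estimates (0/9 proved); BetaPertH ⇐
(D1) ∧ (D4) ∧ CAP+tail; G-an2-4 gates asym, D1 and NE2/3/4.»

WHAT THIS FILE PROVES (0 sorry, 0 `def`; `M_t = fine (Lb·1) (cubic (d+1) (2(t+1)))`, `e = unitIdx⁻¹`, `n_k = lev L k`; the tent family DISPLAYED as a hypothesis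
`hVdef : ∀ t x k μ u, V t x k μ u = [μ = x₂]·max(−ρ_{k,x}(u), 0)`, no definition introduced):
* §1 `unitIdx_symm_fst`, `unitIdx_symm_snd`, `toM_unitIdx_symm`, `iota_zero`, **`ctr_unitIdx_symm_castT`** (`ctr_k (e(ẑ, μ′)) = (n_k·z)^` on every torus).
* §2 **`tendsto_tent_reading`** — along ANY cubic side sequence `side t → ∞`: the tent family's readings `V_{t, e(ẑ_t, μ′)}^{(k)}{}_μ(ŵ_t, f)` converge for all integer `z, w` (they are eventually
  `[μ = μ′]·max(1 − ‖w − n_kz‖_∞∕n_k, 0)`).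
* §3 **`conv_oneLoop_loopCov_tentLegs`** — PART 200's END for the tent family with NOTHING displayed: `d + 1 ≥ 3`, `L ≥ 2`, every `Lb ≥ 1`, `a > 0`, `μ ≠ ν` ⟹ `∃ κ₁ > 0, C, C′ ≥ 0, Π` with
  `IsInfiniteVolumeLimit (Lb·1·2(t+1)) (Re (Γ_{t,k}(Y_{t,k} ⊗ₖ Y_{t,k})Γ_{t,k}ᴴ)(e(·,μ′),e(0,ν′))) (Π k)`, `UniformDecay`, `StepRate √(L⁻¹)`, `KernelInputs (d+1)`, second-moment convergence, where
  `Γ_{t,k}(x,(q,r)) = X_{t,x,k}(q,r)` are the insertion words of the tent backgrounds — V196's loop contraction as an UNCONDITIONAL theorem for one explicit family of local unit backgrounds.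
WHAT IT DOES NOT DO: the indicator family `1_{block x}`; the identification with Bałaban's `Π⁰` and the trace form (row an1's dictionary); a value for any constant.  SUPPLIER work; NEVER
«G-an2-4 closed»; NOT (CONV-C), NOT D1, NOT `BetaPertH`, NOT continuum, NOT Clay.  Records: `HOME/b2b-balaban-gan24-p3/gen62/README.md`.
-/

noncomputable section

open scoped BigOperators ComplexConjugate Matrix Matrix.Norms.L2Operator Kronecker
open Filter Topology Finset Matrix

namespace Summit.QuantumFields.BalabanUV.Beta.GAN24.TentBackgroundLegs

open Literature.MathematicalPhysics.QuantumFieldTheory.Balaban1983to89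
open Literature.MathematicalPhysics.QuantumFieldTheory.Balaban1983to89.B5Prop11Plancherel (Tor fine)
open Literature.MathematicalPhysics.QuantumFieldTheory.Balaban1983to89.B5Block118 (up iota bpt)
open Literature.MathematicalPhysics.QuantumFieldTheory.Balaban1983to89.B5RealFields (reM)
open Literature.MathematicalPhysics.QuantumFieldTheory.Balaban1983to89.B5G183RateUnitTower (lev)
open Literature.MathematicalPhysics.QuantumFieldTheory.Balaban1983to89.B12Sec2to5 (betaPrime510)
open Literature.MathematicalPhysics.QuantumFieldTheory.Balaban1983to89.Beta (IsInfiniteVolumeLimit)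
open Literature.MathematicalPhysics.QuantumFieldTheory.Balaban1983to89.Beta.FreeLegDictionary (cubic)
open Literature.MathematicalPhysics.QuantumFieldTheory.Balaban1983to89.Beta.BlockKernelVolumeSockets (evenPeriod tendsto_evenPeriod)
open Literature.MathematicalPhysics.QuantumFieldTheory.Balaban1983to89.Beta.VectorTails (castT)
open Literature.MathematicalPhysics.QuantumFieldTheory.Balaban1983to89.Beta.VectorTailsCov (tdist)
open Literature.MathematicalPhysics.QuantumFieldTheory.Balaban1983to89.Beta.PoissonInterior (supNorm)
open Literature.MathematicalPhysics.QuantumFieldTheory.Balaban1983to89.Beta.LimitRate (StepRate limKernelOf KernelInputs)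
open Literature.MathematicalPhysics.QuantumFieldTheory.Balaban1983to89.Beta.CompositionSingular (flucCov)
open Literature.MathematicalPhysics.QuantumFieldTheory.Balaban1983to89.Beta.BlockEffectiveAction (DelK)
open Summit.QuantumFields.BalabanUV.T4Continuum.BalabanLineAverage (QB)
open Summit.QuantumFields.BalabanUV.T4Continuum.BalabanAveragedTowerModes (par rem)
open Summit.QuantumFields.BalabanUV.T4Continuum.CovariantAveragingTower (avgTow)
open Summit.QuantumFields.BalabanUV.T4Continuum.BalabanAveragedTowerUnit (idx QBlev calGlev unitCovB one_le_lev')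
open Summit.QuantumFields.BalabanUV.T4Continuum.BalabanAveragedCoerciveTower (unitIdx unitSites)
open Summit.QuantumFields.BalabanUV.T4Continuum.CTKingTowerWeights (rho rhoSite ctr toM rho_apply distK)
open Summit.QuantumFields.BalabanUV.T4Continuum.FirstOrderBackgroundModel (LipschitzBackground Pmodel)
open Summit.QuantumFields.BalabanUV.Beta.GAN24.InsertionChainDecayBalaban (toM_eq_unitSites)
open Summit.QuantumFields.BalabanUV.Beta.GAN24.VolumeLimitCovariance (up_castT_mul)
open Summit.QuantumFields.BalabanUV.Beta.GAN24.OneStepConstraintAxialDelKVolumeLimitDecay (tdist_castT_eventually)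
open Summit.QuantumFields.BalabanUV.Beta.GAN24.OneStepLoopContractionLegs (conv_oneLoop_loopCov_insertionLegs)
open Summit.QuantumFields.BalabanUV.Beta.GAN24.KingWeightTwoLevel (lipschitzBackground_tent rho_nonpos_of_tent_ne_zero)

variable {d : ℕ} (L : ℕ) [NeZero L]

/-! ## §1 The centre of an integer root is the reading of `n_k·z` -/

section Root

variable {D : ℕ} (M : Fin D → ℕ) [hM : ∀ μ, NeZero (M μ)]

omit [NeZero L] hM in
/-- `(e(c, μ′))₁ = unitSites⁻¹ c`. [folklore] -/
theorem unitIdx_symm_fst (c : Tor M) (μ' : Fin D) : ((unitIdx L M).symm (c, μ')).1 = (unitSites M).symm c := rfl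

omit [NeZero L] hM in
/-- `(e(c, μ′))₂ = μ′`. [folklore] -/
theorem unitIdx_symm_snd (c : Tor M) (μ' : Fin D) : ((unitIdx L M).symm (c, μ')).2 = μ' := rfl

/-- `toM (e(c, μ′))₁ = c` (both readings keep the integer coordinates). [folklore] -/
theorem toM_unitIdx_symm (c : Tor M) (μ' : Fin D) : toM L M ((unitIdx L M).symm (c, μ')).1 = c := by
  rw [unitIdx_symm_fst, toM_eq_unitSites, Equiv.apply_symm_apply]

omit hM in
/-- the zero offset is the zero fine vector. [folklore] -/
theorem iota_zero (n : ℕ) [NeZero n] : iota n M (0 : Fin D → Fin n) = 0 := by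
  funext ν; simp [iota]

/-- **`ctr_unitIdx_symm_castT`** — THE CENTRE OF AN INTEGER ROOT: `ctr_k (e(ẑ, μ′)) = (n_k·z)^` on the fine torus of level `k` (NE2's `ctr` = the corner `bpt n_k M (toM ·) 0`; PART 139's
`up_castT_mul`). [folklore] -/
theorem ctr_unitIdx_symm_castT (k : ℕ) (z : Fin D → ℤ) (μ' : Fin D) :
    ctr L M k ((unitIdx L M).symm (castT M z, μ')) = castT (fine (lev L k) M) (fun i => ((lev L k : ℕ) : ℤ) * z i) := by
  show up (lev L k) M (toM L M ((unitIdx L M).symm (castT M z, μ')).1) + iota (lev L k) M 0 = _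
  rw [toM_unitIdx_symm, up_castT_mul, iota_zero, add_zero]

end Root

/-! ## §2 The tent family has pointwise limits about every integer root, along any cubic side sequence -/

section Readings

variable {D : ℕ} {side : ℕ → ℕ} [∀ t, NeZero (side t)]

/-- **`tendsto_tent_reading` — EL₁ OF THE TENT FAMILY ABOUT INTEGER ROOTS** [our proof] (ANY cubic side sequence `side t → ∞`; the family DISPLAYED as a hypothesis): for all integer `z, w`,
all `μ′, k, μ, f`, the reading `V_{t, e(ẑ_t, μ′)}^{(k)}{}_μ(ŵ_t, f)` converges — it is eventually the constant `[μ = μ′]·max(−(‖w − n_kz‖_∞∕n_k − 1), 0)` (`ctr_unitIdx_symm_castT` + PART 192's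
`tdist_castT_eventually` on the fine torus of side `n_k·side t`).  The `hel` input of PART 200 for this family. -/
theorem tendsto_tent_reading (hside : Tendsto side atTop atTop)
    {V : (t : ℕ) → idx L (cubic D (side t)) 0 → (k : ℕ) → Fin D → (idx L (cubic D (side t)) k → ℂ)}
    (hVdef : ∀ t x k μ u, V t x k μ u = if μ = x.2 then (((max (-rho L (cubic D (side t)) k x u) 0 : ℝ)) : ℂ) else 0)
    (z : Fin D → ℤ) (μ' : Fin D) (k : ℕ) (μ f : Fin D) (w : Fin D → ℤ) :
    ∃ s : ℂ, Tendsto (fun t => V t ((unitIdx L (cubic D (side t))).symm (castT (cubic D (side t)) z, μ')) k μ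
      (castT (fine (lev L k) (cubic D (side t))) w, f)) atTop (𝓝 s) := by
  by_cases hμ : μ = μ'
  · have hside' : Tendsto (fun t => lev L k * side t) atTop atTop :=
      Filter.Tendsto.const_mul_atTop' (Nat.pos_of_ne_zero (NeZero.ne (lev L k))) hside
    refine ⟨(((max (-((((supNorm (w - fun i => ((lev L k : ℕ) : ℤ) * z i) : ℕ) : ℝ) / (lev L k : ℝ)) - 1)) 0 : ℝ)) : ℂ), tendsto_const_nhds.congr' ?_⟩
    filter_upwards [tdist_castT_eventually (d := D) (side := fun t => lev L k * side t) hside' (fun i => ((lev L k : ℕ) : ℤ) * z i) w] with t ht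
    have ht' : tdist (castT (fine (lev L k) (cubic D (side t))) (fun i => ((lev L k : ℕ) : ℤ) * z i)) (castT (fine (lev L k) (cubic D (side t))) w)
        = supNorm (w - fun i => ((lev L k : ℕ) : ℤ) * z i) := ht
    rw [hVdef, unitIdx_symm_snd, if_pos hμ, rho_apply]
    unfold rhoSite
    rw [ctr_unitIdx_symm_castT, ht']
  · exact ⟨0, tendsto_const_nhds.congr fun t => by rw [hVdef, unitIdx_symm_snd, if_neg hμ]⟩

end Readings

/-! ## §3 THE END for the tent family: V196's loop contraction with nothing displayed -/

variable (Lb : ℕ) [NeZero Lb] (a : ℝ) (ha : 0 < a)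

/-- **`conv_oneLoop_loopCov_tentLegs` — CENSUS V196 (ζ) FOR THE TENT FAMILY, NOTHING DISPLAYED** [our proof] (`d + 1 ≥ 3`, `L ≥ 2`, every `Lb ≥ 1`, `a > 0`, `μ ≠ ν`, coarse volumes `2(t+1)`,
`M_t = fine (Lb·1) (cubic (2(t+1)))`; the tent family `V_{t,x}^{(k)}(u) = [μ = x₂]·max(−ρ_{k,x}(u), 0)` DISPLAYED as the hypothesis `hVdef`, no definition): the one-loop contraction
`Γ_{t,k}(Y_{t,k} ⊗ₖ Y_{t,k})Γ_{t,k}ᴴ` of the gauge-fixed loop covariance `Y = c⁻¹𝒢c⁻¹` with the insertion-word legs of the tent backgrounds has the whole `LimitRate` END on `ℤ^{d+1}` —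
PART 200 fed with PART 201 (`LipschitzBackground … 1 1`, support where `ρ ≤ 0`) and §2 (EL₁).  The first explicit family of local unit backgrounds for which V196's loop contraction is an
unconditional theorem. [cite: Balaban1987RG1, (1.20)–(1.22) p.264 (shapes)] -/
theorem conv_oneLoop_loopCov_tentLegs (hL : 2 ≤ L) (hd : 2 ≤ d) {μ ν : Fin (d + 1)} (hne : μ ≠ ν)
    {V : (t : ℕ) → idx L (fine (Lb * 1) (cubic (d + 1) (evenPeriod t))) 0 → (k : ℕ) → Fin (d + 1) → (idx L (fine (Lb * 1) (cubic (d + 1) (evenPeriod t))) k → ℂ)}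
    (hVdef : ∀ t x k μ u, V t x k μ u = if μ = x.2 then (((max (-rho L (fine (Lb * 1) (cubic (d + 1) (evenPeriod t))) k x u) 0 : ℝ)) : ℂ) else 0) :
    ∃ κ₁ C C' : ℝ, 0 < κ₁ ∧ 0 ≤ C ∧ 0 ≤ C' ∧ ∃ Pinf : ℕ → B12Beta.Kernel (d + 1),
      (∀ k, IsInfiniteVolumeLimit (fun t => Lb * 1 * evenPeriod t)
        (fun t μ' ν' (z : Beta.Site (d + 1) (Lb * 1 * evenPeriod t)) => (((Matrix.of fun (x : idx L (fine (Lb * 1) (cubic (d + 1) (evenPeriod t))) 0) (q : idx L (fine (Lb * 1) (cubic (d + 1) (evenPeriod t))) 0 × idx L (fine (Lb * 1) (cubic (d + 1) (evenPeriod t))) 0) => avgTow (QBlev L (fine (Lb * 1) (cubic (d + 1) (evenPeriod t)))) ((L : ℝ) ^ (d + 1)) (fun k => calGlev L (fine (Lb * 1) (cubic (d + 1) (evenPeriod t))) a ha k * Pmodel L (fine (Lb * 1) (cubic (d + 1) (evenPeriod t))) (V t x) k * calGlev L (fine (Lb * 1) (cubic (d + 1) (evenPeriod t))) a ha k) k q.1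 q.2) * ((((unitCovB L (fine (Lb * 1) (cubic (d + 1) (evenPeriod t))) a ha k)⁻¹ * (((flucCov (reM (DelK (lev L k) (one_le_lev' L k) (fine (Lb * 1) (cubic (d + 1) (evenPeriod t))) a ha)) (Matrix.fromRows (reM (QB 1 Lb (cubic (d + 1) (evenPeriod t)))) (fun (t' : {x : Tor (fine (Lb * 1) (cubic (d + 1) (evenPeriod t))) × Fin (d + 1) // (∀ ν, ν < x.2 → ((rem 1 Lb (cubic (d + 1) (evenPeriod t)) x.1 ν : ℕ)) = 0) ∧ ((rem 1 Lb (cubic (d + 1) (evenPeriod t)) x.1 x.2 : ℕ)) + 1 < Lb}) (x : Tor (fine (Lb * 1) (cubic (d + 1) (evenPeriod t))) × Fin (d + 1)) => if x = (Function.Embedding.subtype (fun x : Tor (fine (Lb * 1) (cubic (d + 1) (evenPeriod t))) × Fin (d + 1) => (∀ ν, ν < x.2 → ((rem 1 Lb (cubic (d + 1) (evenPeriod t)) x.1 ν : ℕ)) = 0) ∧ ((rem 1 Lb (cubic (d + 1) (evenPeriod t)) x.1 x.2 : ℕ)) + 1 < Lb)) t' then (1 : ℝ) else 0))).map ((↑)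 : ℝ → ℂ)).submatrix (unitIdx L (fine (Lb * 1) (cubic (d + 1) (evenPeriod t)))) (unitIdx L (fine (Lb * 1) (cubic (d + 1) (evenPeriod t))))) * (unitCovB L (fine (Lb * 1) (cubic (d + 1) (evenPeriod t))) a ha k)⁻¹)) ⊗ₖ (((unitCovB L (fine (Lb * 1) (cubic (d + 1) (evenPeriod t))) a ha k)⁻¹ * (((flucCov (reM (DelK (lev L k) (one_le_lev' L k) (fine (Lb * 1) (cubic (d + 1) (evenPeriod t))) a ha)) (Matrix.fromRows (reM (QB 1 Lb (cubic (d + 1) (evenPeriod t)))) (fun (t' : {x : Tor (fine (Lb * 1) (cubic (d + 1) (evenPeriod t))) × Fin (d + 1) // (∀ ν, ν < x.2 → ((rem 1 Lb (cubic (d + 1) (evenPeriod t)) x.1 ν : ℕ)) = 0) ∧ ((rem 1 Lb (cubic (d + 1) (evenPeriod t)) x.1 x.2 : ℕ)) + 1 < Lb}) (x : Tor (fine (Lb * 1) (cubic (d + 1) (evenPeriod t))) × Fin (d + 1)) => if x = (Function.Embedding.subtype (fun x : Tor (fine (Lb * 1) (cubic (d + 1) (evenPeriod t))) × Fin (d +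 1) => (∀ ν, ν < x.2 → ((rem 1 Lb (cubic (d + 1) (evenPeriod t)) x.1 ν : ℕ)) = 0) ∧ ((rem 1 Lb (cubic (d + 1) (evenPeriod t)) x.1 x.2 : ℕ)) + 1 < Lb)) t' then (1 : ℝ) else 0))).map ((↑) : ℝ → ℂ)).submatrix (unitIdx L (fine (Lb * 1) (cubic (d + 1) (evenPeriod t)))) (unitIdx L (fine (Lb * 1) (cubic (d + 1) (evenPeriod t))))) * (unitCovB L (fine (Lb * 1) (cubic (d + 1) (evenPeriod t))) a ha k)⁻¹))) * ((Matrix.of fun (x : idx L (fine (Lb * 1) (cubic (d + 1) (evenPeriod t))) 0) (q : idx L (fine (Lb * 1) (cubic (d + 1) (evenPeriod t))) 0 × idx L (fine (Lb * 1) (cubic (d + 1) (evenPeriod t))) 0) => avgTow (QBlev L (fine (Lb * 1) (cubic (d + 1) (evenPeriod t)))) ((L : ℝ) ^ (d + 1)) (fun k => calGlev L (fine (Lb * 1) (cubic (d + 1) (evenPeriod t))) a ha k * Pmodel L (fine (Lb * 1) (cubic (d + 1) (evenPeriod t))) (V t x) k * calGlev L (fine (Lb * 1) (cubic (d + 1)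 (evenPeriod t))) a ha k) k q.1 q.2))ᴴ) ((unitIdx L (fine (Lb * 1) (cubic (d + 1) (evenPeriod t)))).symm (z, μ')) ((unitIdx L (fine (Lb * 1) (cubic (d + 1) (evenPeriod t)))).symm (0, ν'))).re) (Pinf k)) ∧
      Beta.LimitRate.UniformDecay Pinf μ ν C ((κ₁ / 4) / (((d + 1 : ℕ)) : ℝ)) ∧
      StepRate Pinf μ ν C' ((κ₁ / 4) / (((d + 1 : ℕ)) : ℝ)) (Real.sqrt ((L : ℝ)⁻¹)) ∧
      (∃ K : KernelInputs (d + 1) Pinf, K.θ = Real.sqrt ((L : ℝ)⁻¹) ∧ K.c₀ = betaPrime510 (d + 1) (C' / (1 - Real.sqrt ((L : ℝ)⁻¹))) ((κ₁ / 4) / (((d + 1 : ℕ)) : ℝ)) ∧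
        K.Pinf = limKernelOf Pinf ∧ K.μ = μ ∧ K.ν = ν) ∧
      (∀ k, |B12Beta.secondMoment (Pinf k) μ ν - B12Beta.secondMoment (limKernelOf Pinf) μ ν|
          ≤ betaPrime510 (d + 1) (C' / (1 - Real.sqrt ((L : ℝ)⁻¹))) ((κ₁ / 4) / (((d + 1 : ℕ)) : ℝ)) * Real.sqrt ((L : ℝ)⁻¹) ^ k) :=
  conv_oneLoop_loopCov_insertionLegs L Lb a ha hL hd hne (α := 1) (β := 1) (c₀ := 0)
    (fun t i => lipschitzBackground_tent L (fine (Lb * 1) (cubic (d + 1) (evenPeriod t))) (le_trans (by norm_num) hL) i (hVdef t i))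
    (fun t i k μ₀ u h => rho_nonpos_of_tent_ne_zero L (fine (Lb * 1) (cubic (d + 1) (evenPeriod t))) i (hVdef t i) k μ₀ u h)
    (fun z μ' k μ₀ f w => tendsto_tent_reading L (D := d + 1) (side := fun t => Lb * 1 * evenPeriod t)
      (Filter.Tendsto.const_mul_atTop' (Nat.pos_of_ne_zero (NeZero.ne (Lb * 1))) tendsto_evenPeriod) (V := V) hVdef z μ' k μ₀ f w)

end Summit.QuantumFields.BalabanUV.Beta.GAN24.TentBackgroundLegs

end
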